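import Mathlib
import Literature.NumberTheory.LFunctions.Zhang2022.Section2CriticalLineReality
import Literature.NumberTheory.LFunctions.Zhang2022.Section2SmoothWeight
import HarnessLib

/-!
# Zhang (2022), §8 p. 16 (proof of Lemma 8.1): "By (2.11) and analytic continuation" — the
# Schwarz reflection `conj M(s,ψ) = M(1−s̄,ψ)` off the critical line, `conj 𝒞̃(s,ψ) = −𝒞̃(s′,ψ)`,
# the reflected Dirichlet polynomials and weight, and `−Ĩ₁⁻(a₁,a₂;ψ) = conj Ĩ₁⁺(ā₂,ā₁;ψ)`,
# kernel-checked

Topic `Literature/NumberTheory/LFunctions/Zhang2022` (Landau–Siegel autopsy tree; verdict-neutral).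
Y. Zhang, *Discrete mean estimates and the Landau–Siegel zero*, arXiv:2211.02515v1 (2022) — **an
unrefereed manuscript, a claimed result under adjudication** (cell pub-zhang: audit + repair census
of arXiv:2211.02515; no claim about Landau–Siegel) — §8, p. 16, proof of Lemma 8.1:

> Write `𝒞̃(s,ψ) = −i M(s+β₁,ψ)M(s+β₂,ψ)M(s+β₃,ψ)/M(s,ψ)`. […] where
> `Ĩ₁^±(a₁,a₂;ψ) = (1/2πi) ∫_{𝔍(±α)} 𝒞̃(s,ψ)A(a₁;s,ψ)A(a₂,1−s,ψ̄)ω(s) ds`.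
> Write `s′ = 1 − s̄`. If `s = α + s₀ + iv ∈ 𝔍(α)`, then `s′ = −α + s₀ + iv ∈ 𝔍(−α)`.
> By (2.11) and analytic continuation, for `s ∈ 𝔍(α)` we have
> `conj 𝒞̃(s,ψ) = −𝒞̃(s′,ψ)`
> and
> `conj( A(a₁;s,ψ)A(a₂,1−s,ψ̄)ω(s) ) = A(ā₂;s′,ψ)A(ā₁,1−s′,ψ̄)ω(s′)`.
> These together imply that `−Ĩ₁⁻(a₁,a₂;ψ) = conj Ĩ₁⁺(ā₂,ā₁;ψ)`.
> Hence, by (8.6) [sc. (8.1)],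
> `Σ_{ρ∈𝔷̃(ψ)} 𝒞*(ρ,ψ)A(a₁;ρ,ψ)A(a₂,1−ρ,ψ̄)ω(ρ) = Ĩ₁⁺(a₁,a₂;ψ) + conj Ĩ₁⁺(ā₂,ā₁;ψ) + O(ε)`.

Here (§2 p. 5) `M(s,ψ) = Y(s,ψ)L(s,ψ)` with `Y` an analytic square root of `Z(·,ψ)⁻¹` on the upper
half-plane and `M(1/2+it,ψ) ∈ ℝ` ((2.11), the tree's `GammaFactor.M_half_im_eq_zero`); the `β_j` of
(2.13) are purely imaginary, `β_j = iv_j`; (§7 p. 13) `ā = {ā(n)}`, `ā(n) = conj a(n)`,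
`A(a;s,ψ) = Σ_n a(n)ψ(n)n^{−s}`, `A(a;1−s,ψ̄) = Σ_n a(n)ψ̄(n)n^{s−1}` — finite sums, since `a(n) = 0`
for `n ≥ PT^{−2}` by (7.2); `𝔍(z)` denotes the segment `[s₀+z−i𝓛₁, s₀+z+i𝓛₁]`, `s₀ = 1/2 + 2πit₀`
((2.8), the tree's `SmoothWeight.s0`) and `ω` is the weight (2.15) (the tree's `SmoothWeight.omega`).

This file PROVES, for a primitive character `θ` to any modulus `k ≠ 1` (the source: `k = p`
prime), any `Y` holomorphic on `{Im s > 0}` with `Y² = Z(·,θ)⁻¹` there, and free real parameters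
`t₀, 𝓛₁, 𝓛₂, v₁, v₂, v₃, α`:

* `GammaFactor.conj_M_eq` — **"(2.11) and analytic continuation"**: `conj M(s,θ) = M(1 − s̄,θ)`
  for every `s` with `Im s > 0` (the Schwarz reflection in the critical line: `s ↦ conj M(1−s̄)` is
  holomorphic on the upper half-plane and agrees with `M` on `Re s = 1/2` by (2.11); identity theorem);
* `Lemma81.conj_calCtilde_eq` — `conj 𝒞̃(s,ψ) = −𝒞̃(s′,ψ)` (`s′ = 1 − s̄`) whenever `Im s > 0` and
  `Im s + v_j > 0`;
* `Lemma81.one_sub_conj_eq` — "if `s = α + s₀ + iv` then `s′ = −α + s₀ + iv`";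
* `Lemma81.conj_dirPoly`, `Lemma81.conj_omega`, `Lemma81.conj_dirPoly_mul_omega` — the second display:
  `conj( A(a₁;s,ψ)A(a₂,1−s,ψ̄)ω(s) ) = A(ā₂;s′,ψ)A(ā₁,1−s′,ψ̄)ω(s′)` (at every `s`);
* `Lemma81.neg_Itilde_neg_eq_conj` — **`−Ĩ₁⁻(a₁,a₂;ψ) = conj Ĩ₁⁺(ā₂,ā₁;ψ)`**, with
  `Ĩ₁^{±}` the segment integrals over `𝔍(±α)` written in the parametrisation `s = ±α + s₀ + iv`,
  `ds = i dv` (`Lemma81.segInt`, `Lemma81.Itilde`), under `|𝓛₁| < 2πt₀` and `v_j ≥ 0` (so that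
  `𝔍(±α)` and its `β_j`-shifts lie in the upper half-plane, where `M` is defined);
* `Lemma81.sum_eq_Itilde_add_conj` — the "Hence" line: (8.1) `S = Ĩ₁⁺ − Ĩ₁⁻ + E` becomes
  `S = Ĩ₁⁺(a₁,a₂) + conj Ĩ₁⁺(ā₂,ā₁) + E`.

What is NOT asserted: (8.1) itself (Lemma 5.9 + residue theorem), Proposition 2.2, or any size
estimate. Nothing about Theorems 1–2 of the source is stated or implied; nothing here bears on the
cell's verdict on (8.24).

## References

* Y. Zhang, arXiv:2211.02515v1 (2022), §8 p. 16 (proof of Lemma 8.1); §2 p. 5 (2.11), (2.13),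
  (2.15); §7 p. 13 (7.1)–(7.2). [cite: Zhang2022LandauSiegel, §8 p. 16 (proof of Lemma 8.1)]
-/

noncomputable section

open Complex Real Filter _root_.Topology Set ComplexConjugate MeasureTheory intervalIntegral

namespace Literature.NumberTheory.LFunctions.Zhang2022

namespace GammaFactor

variable {k : ℕ} [NeZero k]

/-- `M = Y·L(·,θ)` is holomorphic on the upper half-plane when `Y` is (`θ ≠ 1`). [folklore] -/
private theorem differentiableOn_M {θ : DirichletCharacter ℂ k} (hθ1 : θ ≠ 1) {Y : ℂ → ℂ}
    (hYd : DifferentiableOn ℂ Y {s : ℂ | 0 < s.im}) :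
    DifferentiableOn ℂ (fun s => Y s * θ.LFunction s) {s : ℂ | 0 < s.im} :=
  hYd.mul (DirichletCharacter.differentiable_LFunction hθ1).differentiableOn

/-- The reflection of a holomorphic function in the critical line, `s ↦ conj F(1 − s̄)`, is
holomorphic on the upper half-plane (which `s ↦ 1 − s̄` preserves). [folklore] -/
private theorem differentiableOn_conj_one_sub_conj {F : ℂ → ℂ}
    (hF : DifferentiableOn ℂ F {s : ℂ | 0 < s.im}) :
    DifferentiableOn ℂ (fun s => conj (F (1 - conj s))) {s : ℂ | 0 < s.im} := by
  intro s hs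
  have hUo : IsOpen {s : ℂ | 0 < s.im} := isOpen_lt continuous_const Complex.continuous_im
  have hmem : {z : ℂ | 0 < z.im} ∈ 𝓝 (1 - conj s) := hUo.mem_nhds (by simpa using hs)
  have hFa : DifferentiableAt ℂ F (1 - conj s) := hF.differentiableAt hmem
  have h1 : DifferentiableAt ℂ (fun w => F (1 - w)) (conj s) := by
    have hsub : DifferentiableAt ℂ (fun w : ℂ => 1 - w) (conj s) :=
      (differentiableAt_const _).sub differentiableAt_id
    exact DifferentiableAt.comp (conj s) (by simpa using hFa) hsub
  have h2 : DifferentiableAt ℂ (conj ∘ (fun w => F (1 - w)) ∘ conj) s :=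
    differentiableAt_conj_conj_iff.2 h1
  exact h2.differentiableWithinAt

/-- **"By (2.11) and analytic continuation"** (§8 p. 16; §2 p. 5): for `θ` primitive mod `k ≠ 1`,
`Y` holomorphic on the upper half-plane with `Y² = Z(·,θ)⁻¹` and `M = Y·L(·,θ)`, the Schwarz
reflection in the critical line holds off the line: `conj M(s) = M(1 − s̄)` for every `s` with
`Im s > 0`. (The function `s ↦ conj M(1−s̄)` is holomorphic on the upper half-plane and coincides
with `M` on `Re s = 1/2` by (2.11); the upper half-plane is connected, so the identity theorem
applies.) [cite: Zhang2022LandauSiegel, §8 p. 16 (proof of Lemma 8.1)] -/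
theorem conj_M_eq {θ : DirichletCharacter ℂ k} (hθ : θ.IsPrimitive) (hk : k ≠ 1)
    {Y : ℂ → ℂ} (hYd : DifferentiableOn ℂ Y {s : ℂ | 0 < s.im})
    (hY : ∀ s : ℂ, 0 < s.im → Y s ^ 2 = (Zfac θ s)⁻¹) {s : ℂ} (hs : 0 < s.im) :
    conj (Y s * θ.LFunction s) = Y (1 - conj s) * θ.LFunction (1 - conj s) := by
  set M : ℂ → ℂ := fun s => Y s * θ.LFunction s with hM_def
  set g : ℂ → ℂ := fun s => conj (M (1 - conj s)) with hg_def
  have hUo : IsOpen {s : ℂ | 0 < s.im} := isOpen_lt continuous_const Complex.continuous_im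
  have hUc : IsPreconnected {s : ℂ | 0 < s.im} := (convex_halfSpace_im_gt 0).isPreconnected
  have hθ1 : θ ≠ 1 := ne_one_of_isPrimitive hθ hk
  have hMd : DifferentiableOn ℂ M {s : ℂ | 0 < s.im} := differentiableOn_M hθ1 hYd
  have hgd : DifferentiableOn ℂ g {s : ℂ | 0 < s.im} := differentiableOn_conj_one_sub_conj hMd
  -- `M = g` on the upper half-plane, by the identity theorem from the critical line
  have key : EqOn M g {s : ℂ | 0 < s.im} := by
    have hz₀ : (1 / 2 : ℂ) + ((1 : ℝ) : ℂ) * I ∈ {s : ℂ | 0 < s.im} := by simp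
    refine (hMd.analyticOnNhd hUo).eqOn_of_preconnected_of_frequently_eq (hgd.analyticOnNhd hUo)
      hUc hz₀ ?_
    -- the critical line accumulates at `1/2 + i`
    have hT : Tendsto (fun t : ℝ => (1 / 2 : ℂ) + (t : ℂ) * I) (𝓝[≠] 1)
        (𝓝[≠] ((1 / 2 : ℂ) + ((1 : ℝ) : ℂ) * I)) := by
      refine tendsto_nhdsWithin_of_tendsto_nhds_of_eventually_within _
        ((continuous_const.add (Complex.continuous_ofReal.mul continuous_const)).continuousAt.tendsto.mono_left
          nhdsWithin_le_nhds) ?_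
      filter_upwards [self_mem_nhdsWithin] with t ht
      simp only [mem_compl_iff, mem_singleton_iff]
      intro h
      apply ht
      have := congrArg Complex.im h
      simpa using this
    refine hT.frequently (Eventually.frequently ?_)
    have hIoi : Ioi (0 : ℝ) ∈ 𝓝[≠] (1 : ℝ) := mem_nhdsWithin_of_mem_nhds (Ioi_mem_nhds one_pos)
    filter_upwards [hIoi] with t ht
    have h1 : 1 - conj ((1 / 2 : ℂ) + (t : ℂ) * I) = 1 / 2 + (t : ℂ) * I := by
      apply Complex.ext <;> norm_num
    show M ((1 / 2 : ℂ) + (t : ℂ) * I) = conj (M (1 - conj ((1 / 2 : ℂ) + (t : ℂ) * I)))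
    rw [h1]
    have him : (M ((1 / 2 : ℂ) + (t : ℂ) * I)).im = 0 :=
      M_half_im_eq_zero hθ hk ht (hY _ (by simpa using ht))
    exact (Complex.conj_eq_iff_im.2 him).symm
  have h := key hs
  -- `M s = conj (M (1 - conj s))`; conjugate both sides
  simp only [hg_def] at h
  have h' := congrArg conj h
  rw [Complex.conj_conj] at h'
  simpa [hM_def] using h'

end GammaFactor

namespace Lemma81

open GammaFactor SmoothWeight

variable {k : ℕ} [NeZero k]

/-! ### `𝒞̃(s,ψ)` and its reflection -/

/-- **`𝒞̃(s,ψ)`** (§8 p. 16): `−i M(s+β₁,ψ)M(s+β₂,ψ)M(s+β₃,ψ)/M(s,ψ)` with `M = Y·L(·,θ)` and the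
purely imaginary shifts `β_j = iv_j` of (2.13). [cite: Zhang2022LandauSiegel, §8 p. 16 (proof of Lemma 8.1)] -/
def calCtilde (θ : DirichletCharacter ℂ k) (Y : ℂ → ℂ) (v₁ v₂ v₃ : ℝ) (s : ℂ) : ℂ :=
  -I * ((Y (s + v₁ * I) * θ.LFunction (s + v₁ * I)) * (Y (s + v₂ * I) * θ.LFunction (s + v₂ * I))
    * (Y (s + v₃ * I) * θ.LFunction (s + v₃ * I))) / (Y s * θ.LFunction s)

/-- Unfolding lemma for `calCtilde`. [cite: Zhang2022LandauSiegel, §8 p. 16 (proof of Lemma 8.1)] -/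
lemma calCtilde_def (θ : DirichletCharacter ℂ k) (Y : ℂ → ℂ) (v₁ v₂ v₃ : ℝ) (s : ℂ) :
    calCtilde θ Y v₁ v₂ v₃ s =
      -I * ((Y (s + v₁ * I) * θ.LFunction (s + v₁ * I)) * (Y (s + v₂ * I) * θ.LFunction (s + v₂ * I))
        * (Y (s + v₃ * I) * θ.LFunction (s + v₃ * I))) / (Y s * θ.LFunction s) := rfl

/-- `(s + iv)′ = s′ + iv` for real `v` (`s′ = 1 − s̄`): the bookkeeping behind "analytic
continuation" for the imaginary shifts `β_j`. [folklore] -/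
private lemma one_sub_conj_add_mul_I (s : ℂ) (v : ℝ) :
    1 - conj (s + v * I) = (1 - conj s) + v * I := by
  simp only [map_add, map_mul, Complex.conj_ofReal, Complex.conj_I]
  ring

/-- **`conj 𝒞̃(s,ψ) = −𝒞̃(s′,ψ)`, `s′ = 1 − s̄`** (§8 p. 16, first display after "By (2.11) and
analytic continuation"): for `θ` primitive mod `k ≠ 1`, `Y` holomorphic on the upper half-plane
with `Y² = Z(·,θ)⁻¹`, real `v_j` and any `s` with `Im s > 0`, `Im s + v_j > 0` (so that `s`, the
`s + β_j` and their reflections lie where `M` is defined). From `GammaFactor.conj_M_eq`,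
`conj(−i) = i` and `(s + iv_j)′ = s′ + iv_j`. [cite: Zhang2022LandauSiegel, §8 p. 16 (proof of Lemma 8.1)] -/
theorem conj_calCtilde_eq {θ : DirichletCharacter ℂ k} (hθ : θ.IsPrimitive) (hk : k ≠ 1)
    {Y : ℂ → ℂ} (hYd : DifferentiableOn ℂ Y {s : ℂ | 0 < s.im})
    (hY : ∀ s : ℂ, 0 < s.im → Y s ^ 2 = (Zfac θ s)⁻¹) {v₁ v₂ v₃ : ℝ} {s : ℂ} (hs : 0 < s.im)
    (h₁ : 0 < s.im + v₁) (h₂ : 0 < s.im + v₂) (h₃ : 0 < s.im + v₃) :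
    conj (calCtilde θ Y v₁ v₂ v₃ s) = -calCtilde θ Y v₁ v₂ v₃ (1 - conj s) := by
  have hM0 := conj_M_eq hθ hk hYd hY hs
  have hM1 := conj_M_eq hθ hk hYd hY (s := s + v₁ * I) (by simpa using h₁)
  have hM2 := conj_M_eq hθ hk hYd hY (s := s + v₂ * I) (by simpa using h₂)
  have hM3 := conj_M_eq hθ hk hYd hY (s := s + v₃ * I) (by simpa using h₃)
  rw [calCtilde_def, calCtilde_def, map_div₀, map_mul, map_mul, map_mul, map_neg, Complex.conj_I,
    hM0, hM1, hM2, hM3, one_sub_conj_add_mul_I, one_sub_conj_add_mul_I, one_sub_conj_add_mul_I]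
  ring

/-- "Write `s′ = 1 − s̄`. If `s = α + s₀ + iv ∈ 𝔍(α)`, then `s′ = −α + s₀ + iv ∈ 𝔍(−α)`"
(§8 p. 16; `s₀ = 1/2 + 2πit₀`). [cite: Zhang2022LandauSiegel, §8 p. 16 (proof of Lemma 8.1)] -/
theorem one_sub_conj_eq (t₀ a v : ℝ) :
    1 - conj ((a : ℂ) + s0 t₀ + v * I) = ((-a : ℝ) : ℂ) + s0 t₀ + v * I := by
  rw [s0_def]
  simp only [map_add, map_mul, map_div₀, map_one, map_ofNat, Complex.conj_ofReal, Complex.conj_I,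
    Complex.ofReal_neg]
  ring

/-- The reflection preserves the height: `Im(z + s₀ + iv) = 2πt₀ + v` for real `z`. [folklore] -/
private lemma im_add_s0_add (t₀ a v : ℝ) : ((a : ℂ) + s0 t₀ + v * I).im = 2 * π * t₀ + v := by
  rw [s0_def]
  simp

/-! ### The Dirichlet polynomials `A(a;s,ψ)` and the weight under conjugation -/

/-- **`A(a;s,ψ) = Σ_n a(n)ψ(n)n^{−s}`** (§7 p. 13), a FINITE sum over `n < N` ((7.2): `a(n) = 0` for
`n ≥ PT^{−2}`); `A(a;1−s,ψ̄)` of the source is `dirPoly N a ψ⁻¹ (1 − s)`.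
[cite: Zhang2022LandauSiegel, §7 p. 13 (after (7.2))] -/
def dirPoly (N : ℕ) (a : ℕ → ℂ) (ψ : DirichletCharacter ℂ k) (s : ℂ) : ℂ :=
  ∑ n ∈ Finset.range N, a n * ψ n * (n : ℂ) ^ (-s)

omit [NeZero k] in
/-- Unfolding lemma for `dirPoly`. [cite: Zhang2022LandauSiegel, §7 p. 13 (after (7.2))] -/
lemma dirPoly_def (N : ℕ) (a : ℕ → ℂ) (ψ : DirichletCharacter ℂ k) (s : ℂ) :
    dirPoly N a ψ s = ∑ n ∈ Finset.range N, a n * ψ n * (n : ℂ) ^ (-s) := rfl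

/-- `conj (n^{−s}) = n^{−s̄}` for a natural number `n`. [folklore] -/
private lemma conj_natCast_cpow_neg (n : ℕ) (s : ℂ) :
    conj ((n : ℂ) ^ (-s)) = (n : ℂ) ^ (-conj s) := by
  have h := Complex.conj_cpow (n : ℂ) (-conj s)
    (by rw [Complex.natCast_arg]; exact Real.pi_pos.ne)
  rw [Complex.conj_natCast, map_neg, Complex.conj_conj] at h
  exact h.symm

omit [NeZero k] in
/-- `conj ψ(n) = ψ̄(n)` (`ψ̄ = ψ⁻¹` for a Dirichlet character). [folklore] -/
private lemma conj_apply_eq_inv_apply (ψ : DirichletCharacter ℂ k) (n : ZMod k) :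
    conj (ψ n) = ψ⁻¹ n := by
  rw [← MulChar.star_apply']
  rfl

omit [NeZero k] in
/-- **`conj A(a;s,ψ) = A(ā;s̄,ψ̄)`** (§8 p. 16: the ingredients `conj A(a₁;s,ψ) = A(ā₁,1−s′,ψ̄)` and
`conj A(a₂,1−s,ψ̄) = A(ā₂;s′,ψ)` of the second display, since `s̄ = 1 − s′`).
[cite: Zhang2022LandauSiegel, §8 p. 16 (proof of Lemma 8.1)] -/
theorem conj_dirPoly (N : ℕ) (a : ℕ → ℂ) (ψ : DirichletCharacter ℂ k) (s : ℂ) :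
    conj (dirPoly N a ψ s) = dirPoly N (fun n => conj (a n)) ψ⁻¹ (conj s) := by
  rw [dirPoly_def, dirPoly_def, map_sum]
  refine Finset.sum_congr rfl fun n _ => ?_
  rw [map_mul, map_mul, conj_apply_eq_inv_apply, conj_natCast_cpow_neg]

/-- `conj s₀ = 1 − s₀` (`s₀ = 1/2 + 2πit₀`). [folklore] -/
private lemma conj_s0 (t₀ : ℝ) : conj (s0 t₀) = 1 - s0 t₀ := by
  rw [s0_def]
  simp only [map_add, map_mul, map_div₀, map_one, map_ofNat, Complex.conj_ofReal, Complex.conj_I]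
  ring

/-- **`conj ω(s) = ω(s′)`**, `s′ = 1 − s̄` (§8 p. 16, the weight factor of the second display; (2.15)
has real coefficients and `conj(s − s₀) = −(s′ − s₀)`).
[cite: Zhang2022LandauSiegel, §8 p. 16 (proof of Lemma 8.1)] -/
theorem conj_omega (L₂ t₀ : ℝ) (s : ℂ) : conj (omega L₂ t₀ s) = omega L₂ t₀ (1 - conj s) := by
  rw [omega_def, omega_def, map_mul, Complex.conj_ofReal, ← Complex.exp_conj, map_div₀, map_pow,
    map_sub, conj_s0, map_mul, map_pow, Complex.conj_ofReal, map_ofNat]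
  congr 3
  ring

omit [NeZero k] in
/-- **The second display** (§8 p. 16): at every `s`, with `s′ = 1 − s̄`,
`conj( A(a₁;s,ψ)A(a₂,1−s,ψ̄)ω(s) ) = A(ā₂;s′,ψ)A(ā₁,1−s′,ψ̄)ω(s′)`.
[cite: Zhang2022LandauSiegel, §8 p. 16 (proof of Lemma 8.1)] -/
theorem conj_dirPoly_mul_omega (N : ℕ) (a₁ a₂ : ℕ → ℂ) (ψ : DirichletCharacter ℂ k)
    (L₂ t₀ : ℝ) (s : ℂ) :
    conj (dirPoly N a₁ ψ s * dirPoly N a₂ ψ⁻¹ (1 - s) * omega L₂ t₀ s)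
      = dirPoly N (fun n => conj (a₂ n)) ψ (1 - conj s)
          * dirPoly N (fun n => conj (a₁ n)) ψ⁻¹ (1 - (1 - conj s)) * omega L₂ t₀ (1 - conj s) := by
  rw [map_mul, map_mul, conj_dirPoly, conj_dirPoly, inv_inv, conj_omega, map_sub, map_one,
    sub_sub_cancel]
  ring

/-! ### The segment integrals `Ĩ₁^{±}` and `−Ĩ₁⁻(a₁,a₂;ψ) = conj Ĩ₁⁺(ā₂,ā₁;ψ)` -/

/-- **`(1/2πi)∫_{𝔍(z)} F(s) ds`** over the vertical segment `𝔍(z) = [s₀+z−i𝓛₁, s₀+z+i𝓛₁]`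
(§7 p. 13), in the parametrisation `s = z + s₀ + iv`, `−𝓛₁ ≤ v ≤ 𝓛₁`, `ds = i dv`:
`(1/2π)∫_{−𝓛₁}^{𝓛₁} F(z + s₀ + iv) dv`. [cite: Zhang2022LandauSiegel, §7 p. 13; §8 p. 16] -/
def segInt (t₀ L₁ : ℝ) (z : ℂ) (F : ℂ → ℂ) : ℂ :=
  (1 / (2 * π) : ℂ) * ∫ v in (-L₁)..L₁, F (z + s0 t₀ + v * I)

/-- Unfolding lemma for `segInt`. [cite: Zhang2022LandauSiegel, §7 p. 13; §8 p. 16] -/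
lemma segInt_def (t₀ L₁ : ℝ) (z : ℂ) (F : ℂ → ℂ) :
    segInt t₀ L₁ z F = (1 / (2 * π) : ℂ) * ∫ v in (-L₁)..L₁, F (z + s0 t₀ + v * I) := rfl

/-- **`Ĩ₁^{±}(a₁,a₂;ψ)`** (§8 p. 16) at `z = ±α`:
`(1/2πi)∫_{𝔍(z)} 𝒞̃(s,ψ)A(a₁;s,ψ)A(a₂,1−s,ψ̄)ω(s) ds`.
[cite: Zhang2022LandauSiegel, §8 p. 16 (proof of Lemma 8.1)] -/
def Itilde (θ : DirichletCharacter ℂ k) (Y : ℂ → ℂ) (v₁ v₂ v₃ : ℝ) (N : ℕ) (L₂ t₀ L₁ : ℝ)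
    (z : ℂ) (a₁ a₂ : ℕ → ℂ) : ℂ :=
  segInt t₀ L₁ z fun s =>
    calCtilde θ Y v₁ v₂ v₃ s * (dirPoly N a₁ θ s * dirPoly N a₂ θ⁻¹ (1 - s) * omega L₂ t₀ s)

/-- Unfolding lemma for `Itilde`. [cite: Zhang2022LandauSiegel, §8 p. 16 (proof of Lemma 8.1)] -/
lemma Itilde_def (θ : DirichletCharacter ℂ k) (Y : ℂ → ℂ) (v₁ v₂ v₃ : ℝ) (N : ℕ) (L₂ t₀ L₁ : ℝ)
    (z : ℂ) (a₁ a₂ : ℕ → ℂ) :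
    Itilde θ Y v₁ v₂ v₃ N L₂ t₀ L₁ z a₁ a₂ = segInt t₀ L₁ z fun s =>
      calCtilde θ Y v₁ v₂ v₃ s * (dirPoly N a₁ θ s * dirPoly N a₂ θ⁻¹ (1 - s) * omega L₂ t₀ s) :=
  rfl

/-- Conjugation commutes with the interval integral. [folklore] -/
private lemma conj_intervalIntegral (f : ℝ → ℂ) (a b : ℝ) :
    conj (∫ v in a..b, f v) = ∫ v in a..b, conj (f v) := by
  simp only [intervalIntegral, map_sub, integral_conj]

/-- Points of `[−𝓛₁, 𝓛₁]` (in either order) have `|v| ≤ |𝓛₁|`. [folklore] -/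
private lemma abs_le_of_mem_uIcc {L₁ v : ℝ} (hv : v ∈ uIcc (-L₁) L₁) : |v| ≤ |L₁| := by
  rcases mem_uIcc.1 hv with ⟨h1, h2⟩ | ⟨h1, h2⟩
  · exact abs_le.2 ⟨by linarith [neg_abs_le L₁, le_abs_self L₁], by linarith [le_abs_self L₁]⟩
  · exact abs_le.2 ⟨by linarith [neg_abs_le L₁], by linarith [neg_abs_le L₁, le_abs_self L₁]⟩

/-- **"These together imply that `−Ĩ₁⁻(a₁,a₂;ψ) = conj Ĩ₁⁺(ā₂,ā₁;ψ)`"** (§8 p. 16): for `θ`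
primitive mod `k ≠ 1`, `Y` holomorphic on the upper half-plane with `Y² = Z(·,θ)⁻¹`, `v_j ≥ 0`
and `|𝓛₁| < 2πt₀` (so the segments `𝔍(±α)` and their `β_j`-shifts lie in the upper half-plane),
and any `N`, `𝓛₂`, `α`, `a₁`, `a₂`. Pointwise on `𝔍(α)` the integrand of `Ĩ₁⁺(ā₂,ā₁;ψ)`
conjugates to minus the integrand of `Ĩ₁⁻(a₁,a₂;ψ)` at `s′ = −α + s₀ + iv`
(`conj_calCtilde_eq`, `conj_dirPoly_mul_omega`, `one_sub_conj_eq`); conjugation commutes with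
`∫ dv`. [cite: Zhang2022LandauSiegel, §8 p. 16 (proof of Lemma 8.1)] -/
theorem neg_Itilde_neg_eq_conj {θ : DirichletCharacter ℂ k} (hθ : θ.IsPrimitive) (hk : k ≠ 1)
    {Y : ℂ → ℂ} (hYd : DifferentiableOn ℂ Y {s : ℂ | 0 < s.im})
    (hY : ∀ s : ℂ, 0 < s.im → Y s ^ 2 = (Zfac θ s)⁻¹) {v₁ v₂ v₃ : ℝ} (hv₁ : 0 ≤ v₁)
    (hv₂ : 0 ≤ v₂) (hv₃ : 0 ≤ v₃) (N : ℕ) (L₂ : ℝ) {t₀ L₁ : ℝ} (hL : |L₁| < 2 * π * t₀) (α : ℝ)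
    (a₁ a₂ : ℕ → ℂ) :
    -Itilde θ Y v₁ v₂ v₃ N L₂ t₀ L₁ ((-α : ℝ) : ℂ) a₁ a₂
      = conj (Itilde θ Y v₁ v₂ v₃ N L₂ t₀ L₁ (α : ℂ) (fun n => conj (a₂ n)) fun n => conj (a₁ n)) := by
  rw [Itilde_def, Itilde_def, segInt_def, segInt_def, map_mul, conj_intervalIntegral,
    show conj (1 / (2 * π) : ℂ) = 1 / (2 * π) by
      rw [map_div₀, map_one, map_mul, map_ofNat, Complex.conj_ofReal],
    ← mul_neg, ← intervalIntegral.integral_neg]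
  congr 1
  refine intervalIntegral.integral_congr fun v hv => ?_
  have hvabs : |v| ≤ |L₁| := abs_le_of_mem_uIcc hv
  -- the point `s = α + s₀ + iv` of `𝔍(α)` and its shifts lie in the upper half-plane
  have him : ((α : ℂ) + s0 t₀ + v * I).im = 2 * π * t₀ + v := im_add_s0_add t₀ α v
  have hs : 0 < ((α : ℂ) + s0 t₀ + v * I).im := by
    rw [him]; linarith [neg_abs_le v]
  have h₁ : 0 < ((α : ℂ) + s0 t₀ + v * I).im + v₁ := by linarith
  have h₂ : 0 < ((α : ℂ) + s0 t₀ + v * I).im + v₂ := by linarith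
  have h₃ : 0 < ((α : ℂ) + s0 t₀ + v * I).im + v₃ := by linarith
  rw [map_mul, conj_calCtilde_eq hθ hk hYd hY hs h₁ h₂ h₃, conj_dirPoly_mul_omega,
    one_sub_conj_eq t₀ α v]
  have ha₁ : (fun n => conj ((fun n => conj (a₁ n)) n)) = a₁ := funext fun n => Complex.conj_conj _
  have ha₂ : (fun n => conj ((fun n => conj (a₂ n)) n)) = a₂ := funext fun n => Complex.conj_conj _
  rw [ha₁, ha₂]
  ring

/-- **"Hence, by (8.6) [sc. (8.1)]"** (§8 p. 16): once the discrete mean `S` equals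
`Ĩ₁⁺(a₁,a₂;ψ) − Ĩ₁⁻(a₁,a₂;ψ) + E` ((8.1), NOT proved here), the reflection gives
`S = Ĩ₁⁺(a₁,a₂;ψ) + conj Ĩ₁⁺(ā₂,ā₁;ψ) + E`. [cite: Zhang2022LandauSiegel, §8 p. 16 (proof of Lemma 8.1)] -/
theorem sum_eq_Itilde_add_conj {θ : DirichletCharacter ℂ k} (hθ : θ.IsPrimitive) (hk : k ≠ 1)
    {Y : ℂ → ℂ} (hYd : DifferentiableOn ℂ Y {s : ℂ | 0 < s.im})
    (hY : ∀ s : ℂ, 0 < s.im → Y s ^ 2 = (Zfac θ s)⁻¹) {v₁ v₂ v₃ : ℝ} (hv₁ : 0 ≤ v₁)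
    (hv₂ : 0 ≤ v₂) (hv₃ : 0 ≤ v₃) (N : ℕ) (L₂ : ℝ) {t₀ L₁ : ℝ} (hL : |L₁| < 2 * π * t₀) (α : ℝ)
    (a₁ a₂ : ℕ → ℂ) {S E : ℂ}
    (h81 : S = Itilde θ Y v₁ v₂ v₃ N L₂ t₀ L₁ (α : ℂ) a₁ a₂
      - Itilde θ Y v₁ v₂ v₃ N L₂ t₀ L₁ ((-α : ℝ) : ℂ) a₁ a₂ + E) :
    S = Itilde θ Y v₁ v₂ v₃ N L₂ t₀ L₁ (α : ℂ) a₁ a₂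
      + conj (Itilde θ Y v₁ v₂ v₃ N L₂ t₀ L₁ (α : ℂ) (fun n => conj (a₂ n)) fun n => conj (a₁ n))
      + E := by
  rw [h81, sub_eq_add_neg, neg_Itilde_neg_eq_conj hθ hk hYd hY hv₁ hv₂ hv₃ N L₂ hL α a₁ a₂]

end Lemma81

end Literature.NumberTheory.LFunctions.Zhang2022
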